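import Summits.QuantumFields.BalabanUV.Beta.GAN24.DressedSourceZeroModeSucc
import Summits.QuantumFields.BalabanUV.Beta.GAN24.ExchangeESectorLatticeWords
import Summits.QuantumFields.BalabanUV.Beta.GAN24.ForcingCellPairFormLevelZero

/-!
# `BalabanUV.Beta.GAN24.ForcingCellPairFormSucc` — binder row G-an2-4 ∕ (CONV-C), W-slot (α-0), ROW (C)sym AT LEVELS `≥ 1` (the OWNER's two-index tower,
# RULING R-gan24p1-g40-1; typer's PART VI row T6-STEP, SUPPLIER statement `hB0`): **THE LEG-AND-BOND SYMMETRISED CELL CHARGE OF THE LEVEL-`(j+1)` E-FRAME FORCING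
# IS AN ANTISYMMETRIC-PAIR FORM, AND HENCE `hB0` AT EVERY LEVEL** — road-P2 g50's hypothesis `hB0` of `CombChargeTowerClosure.pairFormLS_member_and_faceReads_of_forcingPairForms`
# AT `i = j + 1` in its literal (E pins `cE = Lc^(d+1)`, `cVH = −½·Lc^(2(d+1))`), and the two-case assembly `∀ i, hB0 i` under the END probe's pin equations
# (G-an2-4 CRUX TEAM (2), leaf prover `b2b-balaban-gan24-formalise-leaf-06`, the (γ) hand, gen 55; journal [GAN24LEAF06-G55-INTENT2])

NOT IN PRINT; OUR BOOKKEEPING ([folklore] THE JUNCTION, two `rw`s: leaf-04 g69∕g70's 33_j `DressedSourceZeroModeSucc.zmode_dressedSource_succ_an1_inl_inl` (the ff zero mode of the dressed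
level-`(j+1)` source at an1's tables = `c·κ_j·(EE_direct + EE_swap)`, the two LITERAL `S^E ⊗ S^E` lattice words — its response, `VH` and mixed words cancelled inside by leaf-04's
(A)-tower `CurrentSymTower` ∕ 24_j ∕ 27_j ∕ 30_j) with this lineage's J2 `ExchangeESectorLatticeWords.exists_pairForm_eeWords_smul` (those two words ARE an entrywise antisymmetric pair
form, VALUED through the g52–g54 chain: exit-face slot sums = staircase currents, the `E2–X̃–E2` channel, the pattern table `P_j(μα;νβ)`), then road-P2 F9's
`CombChargeAntisymPairForm.pairFormLS_of_pairForm` and gen 55's `ForcingCellPairFormLevelZero.pairFormLS_forcing_level0_lit` for the level-`0` case; 0 `def`, 0 cited fact,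
0 `def … : Prop`, 0 sorry).  HONEST FRAMING (cell contract, verbatim): «discharging `BetaPertH` makes Bałaban's UV stability UNCONDITIONAL — a real constructive-QFT result; it is
NOT the continuum limit and NOT the Clay problem.»  HONEST DEPENDENCY (verbatim): «continuum YM on T⁴ ⇐ BetaPertH ∧ nine spine estimates (0/9 proved); BetaPertH ⇐ (D1) ∧ (D4) ∧
CAP+tail; G-an2-4 gates asym, D1 and NE2/3/4.»

WHAT ([folklore]; in-block root `ρ = toSite r`, `3 ≤ Lc` (33_j's side condition); every unit pair `s_f s_m`, colour constant `cΛ`, scalars `c cB`, ANY border `B` without ff block;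
the E pins `cE = Lc^(d+1)`, `cVH = −(Lc^(d+1)·½·Lc^(d+1))` inside `SpureRecAt` as in 33_j ∕ J2 — the END probe's `hcE` ∕ `hcVH`):
* §1 **`pairForm_forcing_succ`** (generic `d`): `∃ R antisym², ∀ κ κ′ κ₁ κ₂, zmode Lc b̃_(j+1) (κ,κ′; inl κ₁, inl κ₂) = R κκ₁κ′κ₂ + R κ′κ₁κκ₂` (33_j ∘ J2; the g54 junction probe
  `JunctionProbe33j` with its hypothesis `h33` now DISCHARGED BY NAME);
* §2 **`pairFormLS_forcing_succ`** (generic `d`): `∃ T antisym², ∀ κ κ′ κ₁ κ₂, LS(zmode Lc b̃_(j+1))(κκ′; inl κ₁, inl κ₂) = T κκ₁κ′κ₂ + T κ′κ₁κκ₂ + (T κκ₂κ′κ₁ + T κ′κ₂κκ₁)` (`T = 2R`);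
* §3 **`pairFormLS_forcing_succ_lit`**: `d = 3`, `s_f = sfStep Lc (j+1)`, `s_m = smStep 3 Lc (j+1)`, `c = cE₂ * Lc^(2*(3+1))`, border `vh₂S` — road-P2's binder `hB0` at `i := j+1` with the
  E pins written in, nothing else renamed;
* §5 **`crossed_zmode_forcing_succ`** (generic `d`, `a ≠ b`): the crossed orbit sum `X(zmode_Lc b̃_(j+1))(a,b) = 2·c·κ_j·(Π_j(ba;ab) + Π_j(ab;ba))` with J2's EXPLICIT pairing `Π_j`
  (`eeWords_eq_pairForm`) — row T6-VAL's cell summand per level = ONE Green's-function pairing `⟨q_(ba), E2_(j+1) q_(ab)⟩_cell` (+ its mirror), NOT evaluated;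
* §6 **`crossed_zmode_forcing_succ_lit`**: §5 at `d = 3` in road-P2's letters with the E pins written in (leaf-03 g71's `X(zmode_Lc b̃_(l+1))` currency);
* §4 **`forcingCellPairForms`**: under `hcE : cE = Lc^(3+1)`, `hcVH : cVH = −(Lc^(3+1)·(1∕2)·Lc^(3+1))` (the END probe's pin equations VERBATIM), `∀ i : ℕ, hB0 i` — road-P2's binder
  `hB0` VERBATIM (variables `cE cVH cΛ cE₂ cB`, `vh₂S`), by cases `i = 0` (gen 55's `ForcingCellPairFormLevelZero`) ∕ `i = j+1` (§3).
Asserts NO value of Bałaban's tables beyond an3's ∕ an1's DEFINED ones (the words are VALUED by the g52–g54 chain on those defined tables); discharges road-P2's `hB0` AT EVERY LEVEL at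
the E pins — NOTHING of `hBF` ∕ `hX` ∕ `hXu` ∕ `hstep` ∕ `hSrc` ∕ `hSrcX` ∕ (C)_(≥1) as a whole ∕ (Q-L) ∕ (hW, hWall); NEVER «G-an2-4 closed» as (CONV-C); NOT D1, NOT `BetaPertH`, NOT
continuum, NOT Clay.  2026-08-24; no existing file touched.
-/

noncomputable section

open Finset
open scoped BigOperators
open Literature.MathematicalPhysics.QuantumFieldTheory
open Literature.MathematicalPhysics.QuantumFieldTheory.Balaban1983to89
open Literature.MathematicalPhysics.QuantumFieldTheory.Balaban1983to89.Beta
open ExpKernelCalculus (Site MKer comp shiftK)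
open OneStepResolventKernel (Fib)
open OneStepKernelFamily (KInvStep vertexOfK)
open SecondOrderResponse (W2SymOfK)
open BalabanStepW2 (K3OfK M2Of)
open BalabanStepJetsSucc (mmRead wE wVH E2)
open AffineAveraging (box toSite)
open AveragingMixedJetTables (mixFFAt)
open Summit.QuantumFields.BalabanUV.Beta.AxialDressingRooted (coDressKBmAt)
open Summit.QuantumFields.BalabanUV.Beta.HessKerDressedUnits (unitK unitS)
open Summit.QuantumFields.BalabanUV.Beta.SecondOrderUnits (unitM unitM₂)
open Summit.QuantumFields.BalabanUV.Beta.SpineRooted (e3OfK SpureRecAt M1At)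
open Summit.QuantumFields.BalabanUV.Beta.WardLocusRecursive (SrecAt)
open Summit.QuantumFields.BalabanUV.Beta.GAN24.BiStencilZeroMode (Tab zmode)
open Summit.QuantumFields.BalabanUV.Beta.GAN24.CombesThomas (sfStep smStep)
open Summit.QuantumFields.BalabanUV.Beta.GAN24.CombChargeAntisymPairForm (pairFormLS_of_pairForm)
open Summit.QuantumFields.BalabanUV.Beta.GAN24.DressedSourceZeroModeSucc (zmode_dressedSource_succ_an1_inl_inl)
open Summit.QuantumFields.BalabanUV.Beta.GAN24.ExchangeESectorLatticeWords (exists_pairForm_eeWords_smul eeWords_eq_pairForm)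
open Summit.QuantumFields.BalabanUV.Beta.GAN24.ForcingCellPairFormLevelZero (pairFormLS_forcing_level0_lit)

namespace Summit.QuantumFields.BalabanUV.Beta.GAN24.ForcingCellPairFormSucc

variable {d : ℕ} {Lc : ℕ} [NeZero Lc] {r : Fin (d + 1) → ℕ}

/-! ## §1 The ff zero mode of the level-`(j+1)` forcing is an entrywise antisymmetric-pair form (33_j ∘ J2) -/

/-- NOT IN PRINT; OUR BOOKKEEPING.  **THE JUNCTION 33_j ∘ J2** (in-block root, `3 ≤ Lc`, every unit pair `s_f s_m`, colour constant `cΛ`, scalars `c cB`, ANY border `B`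
without ff block, an1's tables, the E pins inside `SpureRecAt`; every level `j`): the ff cell zero mode of the level-`(j+1)` E-frame forcing is F9's ENTRYWISE pair form
`R κκ₁κ′κ₂ + R κ′κ₁κκ₂` with `R` antisymmetric in each index pair — `R` is J2's (the valued `S^E ⊗ S^E` words). -/
theorem pairForm_forcing_succ (hLc : 3 ≤ Lc) (hr : r ∈ box (d + 1) Lc) (sf sm cΛ : ℝ) (j : ℕ)
    {B : Tab d} (hBff : ∀ κ u κ' u' x z (α β : Fin (d + 1)), B κ u κ' u' x z (Sum.inl α) (Sum.inl β) = 0) (c cB : ℝ) :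
    ∃ R : Fin (d + 1) → Fin (d + 1) → Fin (d + 1) → Fin (d + 1) → ℝ,
      (∀ a b c e : Fin (d + 1), R b a c e = -R a b c e) ∧ (∀ a b c e : Fin (d + 1), R a b e c = -R a b c e) ∧
      ∀ κ κ' κ₁ κ₂ : Fin (d + 1),
        zmode Lc (fun κ u κ' u' => c • mmRead Lc (K3OfK (unitK sf sm (coDressKBmAt (toSite r) Lc (KInvStep (d := d) Lc (j + 1)))) Lc
        (unitS sf sm (SpureRecAt d Lc (toSite r) ((Lc : ℝ) ^ (d + 1)) (-((Lc : ℝ) ^ (d + 1) * (1 / 2) * (Lc : ℝ) ^ (d + 1))) cΛ (j + 1))) (unitM sf sm (M1At d Lc (toSite r) cΛ (j + 1)))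
        (W2SymOfK (unitK sf sm (coDressKBmAt (toSite r) Lc (KInvStep (d := d) Lc (j + 1)))) Lc
          (unitS sf sm (SpureRecAt d Lc (toSite r) ((Lc : ℝ) ^ (d + 1)) (-((Lc : ℝ) ^ (d + 1) * (1 / 2) * (Lc : ℝ) ^ (d + 1))) cΛ (j + 1)))
          (unitM sf sm (M1At d Lc (toSite r) cΛ (j + 1))) 0 (unitM₂ sf sm (M2Of d Lc (mixFFAt (toSite r) Lc) (j + 1)))) κ u κ' u')
        + cB • B κ u κ' u') κ κ' (Sum.inl κ₁) (Sum.inl κ₂)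
          = R κ κ₁ κ' κ₂ + R κ' κ₁ κ κ₂ := by
  obtain ⟨R, h1, h2, hE⟩ := exists_pairForm_eeWords_smul hr sf sm ((Lc : ℝ) ^ (d + 1) * wE d Lc (j + 1)) cΛ j
    (c * (-((sf * sm * ((((Lc ^ (j + 1 + 1) : ℕ) : ℝ)) ^ (d + 1 + 1))⁻¹) * (sf * sm * ((((Lc ^ (j + 1 + 1) : ℕ) : ℝ)) ^ (d + 1 + 1))⁻¹)) * ((Lc : ℝ) * (Lc : ℝ))))
  refine ⟨R, h1, h2, fun κ κ' κ₁ κ₂ => ?_⟩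
  rw [zmode_dressedSource_succ_an1_inl_inl hLc hr sf sm cΛ j hBff c cB κ κ' κ₁ κ₂]
  exact hE κ κ' κ₁ κ₂

/-! ## §2 Hence its leg-and-bond symmetrised cell charge is a pair form (`hB0` at level `j+1`, generic `d`) -/

/-- NOT IN PRINT; OUR BOOKKEEPING.  **`hB0` AT LEVEL `j+1`** (generic `d`; hypotheses of §1): the leg-and-bond symmetrised ff cell zero mode of the level-`(j+1)` E-frame forcing
is an antisymmetric-pair form in road-P2 F9's spelling — witness `T = 2R`, F9 `pairFormLS_of_pairForm` BY NAME. -/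
theorem pairFormLS_forcing_succ (hLc : 3 ≤ Lc) (hr : r ∈ box (d + 1) Lc) (sf sm cΛ : ℝ) (j : ℕ)
    {B : Tab d} (hBff : ∀ κ u κ' u' x z (α β : Fin (d + 1)), B κ u κ' u' x z (Sum.inl α) (Sum.inl β) = 0) (c cB : ℝ) :
    ∃ T : Fin (d + 1) → Fin (d + 1) → Fin (d + 1) → Fin (d + 1) → ℝ,
      (∀ a b c e : Fin (d + 1), T b a c e = -T a b c e) ∧ (∀ a b c e : Fin (d + 1), T a b e c = -T a b c e) ∧
      ∀ κ κ' κ₁ κ₂ : Fin (d + 1),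
        (zmode Lc (fun κ u κ' u' => c • mmRead Lc (K3OfK (unitK sf sm (coDressKBmAt (toSite r) Lc (KInvStep (d := d) Lc (j + 1)))) Lc
        (unitS sf sm (SpureRecAt d Lc (toSite r) ((Lc : ℝ) ^ (d + 1)) (-((Lc : ℝ) ^ (d + 1) * (1 / 2) * (Lc : ℝ) ^ (d + 1))) cΛ (j + 1))) (unitM sf sm (M1At d Lc (toSite r) cΛ (j + 1)))
        (W2SymOfK (unitK sf sm (coDressKBmAt (toSite r) Lc (KInvStep (d := d) Lc (j + 1)))) Lc
          (unitS sf sm (SpureRecAt d Lc (toSite r) ((Lc : ℝ) ^ (d + 1)) (-((Lc : ℝ) ^ (d + 1) * (1 / 2) * (Lc : ℝ) ^ (d + 1))) cΛ (j + 1)))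
          (unitM sf sm (M1At d Lc (toSite r) cΛ (j + 1))) 0 (unitM₂ sf sm (M2Of d Lc (mixFFAt (toSite r) Lc) (j + 1)))) κ u κ' u')
        + cB • B κ u κ' u') κ κ' (Sum.inl κ₁) (Sum.inl κ₂)
        + zmode Lc (fun κ u κ' u' => c • mmRead Lc (K3OfK (unitK sf sm (coDressKBmAt (toSite r) Lc (KInvStep (d := d) Lc (j + 1)))) Lc
        (unitS sf sm (SpureRecAt d Lc (toSite r) ((Lc : ℝ) ^ (d + 1)) (-((Lc : ℝ) ^ (d + 1) * (1 / 2) * (Lc : ℝ) ^ (d + 1))) cΛ (j + 1))) (unitM sf sm (M1At d Lc (toSite r) cΛ (j + 1)))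
        (W2SymOfK (unitK sf sm (coDressKBmAt (toSite r) Lc (KInvStep (d := d) Lc (j + 1)))) Lc
          (unitS sf sm (SpureRecAt d Lc (toSite r) ((Lc : ℝ) ^ (d + 1)) (-((Lc : ℝ) ^ (d + 1) * (1 / 2) * (Lc : ℝ) ^ (d + 1))) cΛ (j + 1)))
          (unitM sf sm (M1At d Lc (toSite r) cΛ (j + 1))) 0 (unitM₂ sf sm (M2Of d Lc (mixFFAt (toSite r) Lc) (j + 1)))) κ u κ' u')
        + cB • B κ u κ' u') κ' κ (Sum.inl κ₁) (Sum.inl κ₂)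
        + (zmode Lc (fun κ u κ' u' => c • mmRead Lc (K3OfK (unitK sf sm (coDressKBmAt (toSite r) Lc (KInvStep (d := d) Lc (j + 1)))) Lc
        (unitS sf sm (SpureRecAt d Lc (toSite r) ((Lc : ℝ) ^ (d + 1)) (-((Lc : ℝ) ^ (d + 1) * (1 / 2) * (Lc : ℝ) ^ (d + 1))) cΛ (j + 1))) (unitM sf sm (M1At d Lc (toSite r) cΛ (j + 1)))
        (W2SymOfK (unitK sf sm (coDressKBmAt (toSite r) Lc (KInvStep (d := d) Lc (j + 1)))) Lc
          (unitS sf sm (SpureRecAt d Lc (toSite r) ((Lc : ℝ) ^ (d + 1)) (-((Lc : ℝ) ^ (d + 1) * (1 / 2) * (Lc : ℝ) ^ (d + 1))) cΛ (j + 1)))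
          (unitM sf sm (M1At d Lc (toSite r) cΛ (j + 1))) 0 (unitM₂ sf sm (M2Of d Lc (mixFFAt (toSite r) Lc) (j + 1)))) κ u κ' u')
        + cB • B κ u κ' u') κ κ' (Sum.inl κ₂) (Sum.inl κ₁)
        + zmode Lc (fun κ u κ' u' => c • mmRead Lc (K3OfK (unitK sf sm (coDressKBmAt (toSite r) Lc (KInvStep (d := d) Lc (j + 1)))) Lc
        (unitS sf sm (SpureRecAt d Lc (toSite r) ((Lc : ℝ) ^ (d + 1)) (-((Lc : ℝ) ^ (d + 1) * (1 / 2) * (Lc : ℝ) ^ (d + 1))) cΛ (j + 1))) (unitM sf sm (M1At d Lc (toSite r) cΛ (j + 1)))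
        (W2SymOfK (unitK sf sm (coDressKBmAt (toSite r) Lc (KInvStep (d := d) Lc (j + 1)))) Lc
          (unitS sf sm (SpureRecAt d Lc (toSite r) ((Lc : ℝ) ^ (d + 1)) (-((Lc : ℝ) ^ (d + 1) * (1 / 2) * (Lc : ℝ) ^ (d + 1))) cΛ (j + 1)))
          (unitM sf sm (M1At d Lc (toSite r) cΛ (j + 1))) 0 (unitM₂ sf sm (M2Of d Lc (mixFFAt (toSite r) Lc) (j + 1)))) κ u κ' u')
        + cB • B κ u κ' u') κ' κ (Sum.inl κ₂) (Sum.inl κ₁)))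
          = T κ κ₁ κ' κ₂ + T κ' κ₁ κ κ₂ + (T κ κ₂ κ' κ₁ + T κ' κ₂ κ κ₁) := by
  obtain ⟨R, h1, h2, hR⟩ := pairForm_forcing_succ hLc hr sf sm cΛ j hBff c cB
  refine ⟨fun a b c' e => 2 * R a b c' e, fun a b c' e => ?_, fun a b c' e => ?_, fun κ κ' κ₁ κ₂ => ?_⟩
  · dsimp only; rw [h1 a b c' e]; ring
  · dsimp only; rw [h2 a b c' e]; ring
  · exact pairFormLS_of_pairForm
      (A := fun κ κ' κ₁ κ₂ => zmode Lc (fun κ u κ' u' => c • mmRead Lc (K3OfK (unitK sf sm (coDressKBmAt (toSite r) Lc (KInvStep (d := d) Lc (j + 1)))) Lc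
        (unitS sf sm (SpureRecAt d Lc (toSite r) ((Lc : ℝ) ^ (d + 1)) (-((Lc : ℝ) ^ (d + 1) * (1 / 2) * (Lc : ℝ) ^ (d + 1))) cΛ (j + 1))) (unitM sf sm (M1At d Lc (toSite r) cΛ (j + 1)))
        (W2SymOfK (unitK sf sm (coDressKBmAt (toSite r) Lc (KInvStep (d := d) Lc (j + 1)))) Lc
          (unitS sf sm (SpureRecAt d Lc (toSite r) ((Lc : ℝ) ^ (d + 1)) (-((Lc : ℝ) ^ (d + 1) * (1 / 2) * (Lc : ℝ) ^ (d + 1))) cΛ (j + 1)))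
          (unitM sf sm (M1At d Lc (toSite r) cΛ (j + 1))) 0 (unitM₂ sf sm (M2Of d Lc (mixFFAt (toSite r) Lc) (j + 1)))) κ u κ' u')
        + cB • B κ u κ' u') κ κ' (Sum.inl κ₁) (Sum.inl κ₂))
      (P := R) hR κ κ' κ₁ κ₂

/-! ## §3 The same at `d = 3` in road-P2's letters — `CombChargeTowerClosure`'s `hB0` at `i := j+1`, E pins written in -/

/-- NOT IN PRINT; OUR BOOKKEEPING.  **`hB0` AT `i = j+1`, road-P2's LITERAL** (`d = 3`; units `sfStep Lc (j+1)`, `smStep 3 Lc (j+1)`; scale `cE₂ * Lc^(2*(3+1))`; an1's tables; E pins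
`cE := Lc^(3+1)`, `cVH := −(Lc^(3+1)·(1∕2)·Lc^(3+1))`; in-block root, `3 ≤ Lc`; any `cΛ cE₂ cB`; ANY border `vh₂S` without ff block) — the body of road-P2's binder `hB0` with
`i := j+1` and the two E constants substituted, nothing else renamed (§2 instantiated). -/
theorem pairFormLS_forcing_succ_lit {r : Fin (3 + 1) → ℕ} (hLc : 3 ≤ Lc) (hr : r ∈ box (3 + 1) Lc) (cΛ cE₂ cB : ℝ)
    {vh₂S : Tab 3} (hBff : ∀ κ u κ' u' x z (α β : Fin (3 + 1)), vh₂S κ u κ' u' x z (Sum.inl α) (Sum.inl β) = 0) (j : ℕ) :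
    ∃ T : Fin (3 + 1) → Fin (3 + 1) → Fin (3 + 1) → Fin (3 + 1) → ℝ,
      (∀ a b c e : Fin (3 + 1), T b a c e = -T a b c e) ∧ (∀ a b c e : Fin (3 + 1), T a b e c = -T a b c e) ∧
      ∀ κ κ' κ₁ κ₂ : Fin (3 + 1),
        (zmode Lc ((fun κ u κ' u' => (cE₂ * (Lc : ℝ) ^ (2 * (3 + 1))) • mmRead Lc (K3OfK (unitK (sfStep Lc (j + 1)) (smStep 3 Lc (j + 1)) (coDressKBmAt (toSite r) Lc (KInvStep (d := 3) Lc (j + 1)))) Lc (unitS (sfStep Lc (j + 1)) (smStep 3 Lc (j + 1)) (SpureRecAt 3 Lc (toSite r) ((Lc : ℝ) ^ (3 + 1)) (-((Lc : ℝ) ^ (3 + 1) * (1 / 2) * (Lc : ℝ) ^ (3 + 1))) cΛ (j + 1))) (unitM (sfStep Lc (j + 1)) (smStep 3 Lc (j + 1)) (M1At 3 Lc (toSite r) cΛ (j + 1))) (W2SymOfK (unitK (sfStep Lc (j + 1)) (smStep 3 Lc (j + 1)) (coDressKBmAt (toSite r) Lc (KInvStep (d := 3) Lc (j + 1)))) Lc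 (unitS (sfStep Lc (j + 1)) (smStep 3 Lc (j + 1)) (SpureRecAt 3 Lc (toSite r) ((Lc : ℝ) ^ (3 + 1)) (-((Lc : ℝ) ^ (3 + 1) * (1 / 2) * (Lc : ℝ) ^ (3 + 1))) cΛ (j + 1))) (unitM (sfStep Lc (j + 1)) (smStep 3 Lc (j + 1)) (M1At 3 Lc (toSite r) cΛ (j + 1))) 0 (unitM₂ (sfStep Lc (j + 1)) (smStep 3 Lc (j + 1)) (M2Of 3 Lc (mixFFAt (toSite r) Lc) (j + 1)))) κ u κ' u') + cB • vh₂S κ u κ' u')) κ κ' (Sum.inl κ₁) (Sum.inl κ₂)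
      + zmode Lc ((fun κ u κ' u' => (cE₂ * (Lc : ℝ) ^ (2 * (3 + 1))) • mmRead Lc (K3OfK (unitK (sfStep Lc (j + 1)) (smStep 3 Lc (j + 1)) (coDressKBmAt (toSite r) Lc (KInvStep (d := 3) Lc (j + 1)))) Lc (unitS (sfStep Lc (j + 1)) (smStep 3 Lc (j + 1)) (SpureRecAt 3 Lc (toSite r) ((Lc : ℝ) ^ (3 + 1)) (-((Lc : ℝ) ^ (3 + 1) * (1 / 2) * (Lc : ℝ) ^ (3 + 1))) cΛ (j + 1))) (unitM (sfStep Lc (j + 1)) (smStep 3 Lc (j + 1)) (M1At 3 Lc (toSite r) cΛ (j + 1))) (W2SymOfK (unitK (sfStep Lc (j + 1)) (smStep 3 Lc (j + 1)) (coDressKBmAt (toSite r) Lc (KInvStep (d := 3) Lc (j + 1)))) Lc (unitS (sfStep Lc (j + 1)) (smStep 3 Lc (j + 1)) (SpureRecAt 3 Lc (toSite r) ((Lc : ℝ) ^ (3 + 1)) (-((Lc : ℝ) ^ (3 + 1) * (1 / 2) * (Lc : ℝ) ^ (3 + 1))) cΛ (j + 1))) (unitM (sfStep Lc (j + 1)) (smStep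 3 Lc (j + 1)) (M1At 3 Lc (toSite r) cΛ (j + 1))) 0 (unitM₂ (sfStep Lc (j + 1)) (smStep 3 Lc (j + 1)) (M2Of 3 Lc (mixFFAt (toSite r) Lc) (j + 1)))) κ u κ' u') + cB • vh₂S κ u κ' u')) κ' κ (Sum.inl κ₁) (Sum.inl κ₂)
      + (zmode Lc ((fun κ u κ' u' => (cE₂ * (Lc : ℝ) ^ (2 * (3 + 1))) • mmRead Lc (K3OfK (unitK (sfStep Lc (j + 1)) (smStep 3 Lc (j + 1)) (coDressKBmAt (toSite r) Lc (KInvStep (d := 3) Lc (j + 1)))) Lc (unitS (sfStep Lc (j + 1)) (smStep 3 Lc (j + 1)) (SpureRecAt 3 Lc (toSite r) ((Lc : ℝ) ^ (3 + 1)) (-((Lc : ℝ) ^ (3 + 1) * (1 / 2) * (Lc : ℝ) ^ (3 + 1))) cΛ (j + 1))) (unitM (sfStep Lc (j + 1)) (smStep 3 Lc (j + 1)) (M1At 3 Lc (toSite r) cΛ (j + 1))) (W2SymOfK (unitK (sfStep Lc (j + 1)) (smStep 3 Lc (j + 1)) (coDressKBmAt (toSite r) Lc (KInvStep (d := 3)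 Lc (j + 1)))) Lc (unitS (sfStep Lc (j + 1)) (smStep 3 Lc (j + 1)) (SpureRecAt 3 Lc (toSite r) ((Lc : ℝ) ^ (3 + 1)) (-((Lc : ℝ) ^ (3 + 1) * (1 / 2) * (Lc : ℝ) ^ (3 + 1))) cΛ (j + 1))) (unitM (sfStep Lc (j + 1)) (smStep 3 Lc (j + 1)) (M1At 3 Lc (toSite r) cΛ (j + 1))) 0 (unitM₂ (sfStep Lc (j + 1)) (smStep 3 Lc (j + 1)) (M2Of 3 Lc (mixFFAt (toSite r) Lc) (j + 1)))) κ u κ' u') + cB • vh₂S κ u κ' u')) κ κ' (Sum.inl κ₂) (Sum.inl κ₁)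
      + zmode Lc ((fun κ u κ' u' => (cE₂ * (Lc : ℝ) ^ (2 * (3 + 1))) • mmRead Lc (K3OfK (unitK (sfStep Lc (j + 1)) (smStep 3 Lc (j + 1)) (coDressKBmAt (toSite r) Lc (KInvStep (d := 3) Lc (j + 1)))) Lc (unitS (sfStep Lc (j + 1)) (smStep 3 Lc (j + 1)) (SpureRecAt 3 Lc (toSite r) ((Lc : ℝ) ^ (3 + 1)) (-((Lc : ℝ) ^ (3 + 1) * (1 / 2) * (Lc : ℝ) ^ (3 + 1))) cΛ (j + 1))) (unitM (sfStep Lc (j + 1)) (smStep 3 Lc (j + 1)) (M1At 3 Lc (toSite r) cΛ (j + 1))) (W2SymOfK (unitK (sfStep Lc (j + 1)) (smStep 3 Lc (j + 1)) (coDressKBmAt (toSite r) Lc (KInvStep (d := 3) Lc (j + 1)))) Lc (unitS (sfStep Lc (j + 1)) (smStep 3 Lc (j + 1)) (SpureRecAt 3 Lc (toSite r) ((Lc : ℝ) ^ (3 + 1)) (-((Lc : ℝ) ^ (3 + 1) * (1 / 2) * (Lc : ℝ) ^ (3 + 1))) cΛ (j + 1))) (unitM (sfStep Lc (j + 1)) (smStep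 3 Lc (j + 1)) (M1At 3 Lc (toSite r) cΛ (j + 1))) 0 (unitM₂ (sfStep Lc (j + 1)) (smStep 3 Lc (j + 1)) (M2Of 3 Lc (mixFFAt (toSite r) Lc) (j + 1)))) κ u κ' u') + cB • vh₂S κ u κ' u')) κ' κ (Sum.inl κ₂) (Sum.inl κ₁)))
          = T κ κ₁ κ' κ₂ + T κ' κ₁ κ κ₂ + (T κ κ₂ κ' κ₁ + T κ' κ₂ κ κ₁) :=
  pairFormLS_forcing_succ (d := 3) hLc hr (sfStep Lc (j + 1)) (smStep 3 Lc (j + 1)) cΛ j hBff (cE₂ * (Lc : ℝ) ^ (2 * (3 + 1))) cB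

/-! ## §4 `hB0` at every level under the END probe's pin equations -/

/-- NOT IN PRINT; OUR BOOKKEEPING.  **road-P2's SUPPLIER STATEMENT `hB0` AT EVERY LEVEL** (`d = 3`; in-block root, `3 ≤ Lc`; the END probe's pin equations
`hcE : cE = Lc^(3+1)`, `hcVH : cVH = −(Lc^(3+1)·(1∕2)·Lc^(3+1))`; any `cΛ cE₂ cB`; ANY border `vh₂S` without ff block): `∀ i, hB0 i` — `CombChargeTowerClosure`'s binder VERBATIM —
by the two level classes: `i = 0` (gen 55's `ForcingCellPairFormLevelZero.pairFormLS_forcing_level0_lit`, leaf-04's closed form) and `i = j+1` (§3, 33_j ∘ J2). -/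
theorem forcingCellPairForms {r : Fin (3 + 1) → ℕ} (hLc : 3 ≤ Lc) (hr : r ∈ box (3 + 1) Lc) {cE cVH : ℝ} (cΛ cE₂ cB : ℝ)
    (hcE : cE = (Lc : ℝ) ^ (3 + 1)) (hcVH : cVH = -((Lc : ℝ) ^ (3 + 1) * (1 / 2) * (Lc : ℝ) ^ (3 + 1)))
    {vh₂S : Tab 3} (hBff : ∀ κ u κ' u' x z (α β : Fin (3 + 1)), vh₂S κ u κ' u' x z (Sum.inl α) (Sum.inl β) = 0) :
    ∀ i : ℕ, ∃ T : Fin (3 + 1) → Fin (3 + 1) → Fin (3 + 1) → Fin (3 + 1) → ℝ,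
      (∀ a b c e : Fin (3 + 1), T b a c e = -T a b c e) ∧ (∀ a b c e : Fin (3 + 1), T a b e c = -T a b c e) ∧
      ∀ κ κ' κ₁ κ₂ : Fin (3 + 1),
        (zmode Lc ((fun κ u κ' u' => (cE₂ * (Lc : ℝ) ^ (2 * (3 + 1))) • mmRead Lc (K3OfK (unitK (sfStep Lc i) (smStep 3 Lc i) (coDressKBmAt (toSite r) Lc (KInvStep (d := 3) Lc i))) Lc (unitS (sfStep Lc i) (smStep 3 Lc i) (SpureRecAt 3 Lc (toSite r) cE cVH cΛ i)) (unitM (sfStep Lc i) (smStep 3 Lc i) (M1At 3 Lc (toSite r) cΛ i)) (W2SymOfK (unitK (sfStep Lc i) (smStep 3 Lc i) (coDressKBmAt (toSite r) Lc (KInvStep (d := 3) Lc i))) Lc (unitS (sfStep Lc i) (smStep 3 Lc i) (SpureRecAt 3 Lc (toSite r) cE cVH cΛ i)) (unitM (sfStep Lc i) (smStep 3 Lc i) (M1At 3 Lc (toSite r) cΛ i)) 0 (unitM₂ (sfStep Lc i) (smStep 3 Lc i) (M2Of 3 Lc (mixFFAt (toSite r) Lc) i))) κ u κ' u') + cB •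 vh₂S κ u κ' u')) κ κ' (Sum.inl κ₁) (Sum.inl κ₂)
      + zmode Lc ((fun κ u κ' u' => (cE₂ * (Lc : ℝ) ^ (2 * (3 + 1))) • mmRead Lc (K3OfK (unitK (sfStep Lc i) (smStep 3 Lc i) (coDressKBmAt (toSite r) Lc (KInvStep (d := 3) Lc i))) Lc (unitS (sfStep Lc i) (smStep 3 Lc i) (SpureRecAt 3 Lc (toSite r) cE cVH cΛ i)) (unitM (sfStep Lc i) (smStep 3 Lc i) (M1At 3 Lc (toSite r) cΛ i)) (W2SymOfK (unitK (sfStep Lc i) (smStep 3 Lc i) (coDressKBmAt (toSite r) Lc (KInvStep (d := 3) Lc i))) Lc (unitS (sfStep Lc i) (smStep 3 Lc i) (SpureRecAt 3 Lc (toSite r) cE cVH cΛ i)) (unitM (sfStep Lc i) (smStep 3 Lc i) (M1At 3 Lc (toSite r) cΛ i)) 0 (unitM₂ (sfStep Lc i) (smStep 3 Lc i) (M2Of 3 Lc (mixFFAt (toSite r) Lc) i))) κ u κ' u') + cB • vh₂S κ u κ' u')) κ' κ (Sum.inl κ₁) (Sum.inl κ₂)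
      + (zmode Lc ((fun κ u κ' u' => (cE₂ * (Lc : ℝ) ^ (2 * (3 + 1))) • mmRead Lc (K3OfK (unitK (sfStep Lc i) (smStep 3 Lc i) (coDressKBmAt (toSite r) Lc (KInvStep (d := 3) Lc i))) Lc (unitS (sfStep Lc i) (smStep 3 Lc i) (SpureRecAt 3 Lc (toSite r) cE cVH cΛ i)) (unitM (sfStep Lc i) (smStep 3 Lc i) (M1At 3 Lc (toSite r) cΛ i)) (W2SymOfK (unitK (sfStep Lc i) (smStep 3 Lc i) (coDressKBmAt (toSite r) Lc (KInvStep (d := 3) Lc i))) Lc (unitS (sfStep Lc i) (smStep 3 Lc i) (SpureRecAt 3 Lc (toSite r) cE cVH cΛ i)) (unitM (sfStep Lc i) (smStep 3 Lc i) (M1At 3 Lc (toSite r) cΛ i)) 0 (unitM₂ (sfStep Lc i) (smStep 3 Lc i) (M2Of 3 Lc (mixFFAt (toSite r) Lc) i))) κ u κ' u') + cB • vh₂S κ u κ' u')) κ κ' (Sum.inl κ₂) (Sum.inl κ₁)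
      + zmode Lc ((fun κ u κ' u' => (cE₂ * (Lc : ℝ) ^ (2 * (3 + 1))) • mmRead Lc (K3OfK (unitK (sfStep Lc i) (smStep 3 Lc i) (coDressKBmAt (toSite r) Lc (KInvStep (d := 3) Lc i))) Lc (unitS (sfStep Lc i) (smStep 3 Lc i) (SpureRecAt 3 Lc (toSite r) cE cVH cΛ i)) (unitM (sfStep Lc i) (smStep 3 Lc i) (M1At 3 Lc (toSite r) cΛ i)) (W2SymOfK (unitK (sfStep Lc i) (smStep 3 Lc i) (coDressKBmAt (toSite r) Lc (KInvStep (d := 3) Lc i))) Lc (unitS (sfStep Lc i) (smStep 3 Lc i) (SpureRecAt 3 Lc (toSite r) cE cVH cΛ i)) (unitM (sfStep Lc i) (smStep 3 Lc i) (M1At 3 Lc (toSite r) cΛ i)) 0 (unitM₂ (sfStep Lc i) (smStep 3 Lc i) (M2Of 3 Lc (mixFFAt (toSite r) Lc) i))) κ u κ' u') + cB • vh₂S κ u κ' u')) κ' κ (Sum.inl κ₂) (Sum.inl κ₁)))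
          = T κ κ₁ κ' κ₂ + T κ' κ₁ κ κ₂ + (T κ κ₂ κ' κ₁ + T κ' κ₂ κ κ₁) := by
  subst hcE
  subst hcVH
  intro i
  cases i with
  | zero => exact pairFormLS_forcing_level0_lit (by omega) hr _ _ cΛ cE₂ cB hBff
  | succ j => exact pairFormLS_forcing_succ_lit hLc hr cΛ cE₂ cB hBff j

/-! ## §5 The crossed cell VALUE of the level-`(j+1)` forcing: one Green's-function pairing per level (row T6-VAL's cell summand) -/

/-- NOT IN PRINT; OUR BOOKKEEPING.  **THE CROSSED ORBIT SUM OF THE LEVEL-`(j+1)` FORCING's ff CELL ZERO MODE IS TWICE THE SUM OF J2's TWO CROSSED PAIRINGS** (generic `d`;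
hypotheses of §1; `a ≠ b`): `X(zmode_Lc b̃_(j+1))(a,b) := Z abab + Z baab + (Z abba + Z baba) = 2·c·κ_j·(Π_j(b,a;a,b) + Π_j(a,b;b,a))`, `Π_j(κ,κ₁;κ′,κ₂)` = J2's EXPLICIT entry
(`ExchangeESectorLatticeWords.eeWords_eq_pairForm`: `|box|·A_j²·(−¼e_j²)·s_f²·wVH_(j+1)⁻¹·⟨q_(κκ₁), E2_(j+1) q_(κ′κ₂)⟩_cell` with the g53 staircase profiles `q`), the diagonal entries
(`κ = κ₁` or `κ′ = κ₂`) being J2's `0` branches — four `rw`s with 33_j, four with J2, the `if`s decided by `a ≠ b`, `ring`.  THIS IS THE NUMBER row T6-VAL needs per level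
(leaf-03 g71 `CrossedLedgerForcing`: the cell summands `X(zmode_Lc b̃_l)`, `X(zmode_Lc b̃_(l+1))`): a pairing of two bounded `Lc`-periodic profiles through the value Hessian
`E2_(j+1) = mmRead (KInv)` — a Green's-function VALUE, not finite stencil algebra; NOT evaluated here. -/
theorem crossed_zmode_forcing_succ (hLc : 3 ≤ Lc) (hr : r ∈ box (d + 1) Lc) (sf sm cΛ : ℝ) (j : ℕ)
    {B : Tab d} (hBff : ∀ κ u κ' u' x z (α β : Fin (d + 1)), B κ u κ' u' x z (Sum.inl α) (Sum.inl β) = 0) (c cB : ℝ)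
    {a b : Fin (d + 1)} (hab : a ≠ b) :
    zmode Lc (fun κ u κ' u' => c • mmRead Lc (K3OfK (unitK sf sm (coDressKBmAt (toSite r) Lc (KInvStep (d := d) Lc (j + 1)))) Lc
        (unitS sf sm (SpureRecAt d Lc (toSite r) ((Lc : ℝ) ^ (d + 1)) (-((Lc : ℝ) ^ (d + 1) * (1 / 2) * (Lc : ℝ) ^ (d + 1))) cΛ (j + 1))) (unitM sf sm (M1At d Lc (toSite r) cΛ (j + 1)))
        (W2SymOfK (unitK sf sm (coDressKBmAt (toSite r) Lc (KInvStep (d := d) Lc (j + 1)))) Lc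
          (unitS sf sm (SpureRecAt d Lc (toSite r) ((Lc : ℝ) ^ (d + 1)) (-((Lc : ℝ) ^ (d + 1) * (1 / 2) * (Lc : ℝ) ^ (d + 1))) cΛ (j + 1)))
          (unitM sf sm (M1At d Lc (toSite r) cΛ (j + 1))) 0 (unitM₂ sf sm (M2Of d Lc (mixFFAt (toSite r) Lc) (j + 1)))) κ u κ' u')
        + cB • B κ u κ' u') a b (Sum.inl a) (Sum.inl b)
      + zmode Lc (fun κ u κ' u' => c • mmRead Lc (K3OfK (unitK sf sm (coDressKBmAt (toSite r) Lc (KInvStep (d := d) Lc (j + 1)))) Lc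
        (unitS sf sm (SpureRecAt d Lc (toSite r) ((Lc : ℝ) ^ (d + 1)) (-((Lc : ℝ) ^ (d + 1) * (1 / 2) * (Lc : ℝ) ^ (d + 1))) cΛ (j + 1))) (unitM sf sm (M1At d Lc (toSite r) cΛ (j + 1)))
        (W2SymOfK (unitK sf sm (coDressKBmAt (toSite r) Lc (KInvStep (d := d) Lc (j + 1)))) Lc
          (unitS sf sm (SpureRecAt d Lc (toSite r) ((Lc : ℝ) ^ (d + 1)) (-((Lc : ℝ) ^ (d + 1) * (1 / 2) * (Lc : ℝ) ^ (d + 1))) cΛ (j + 1)))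
          (unitM sf sm (M1At d Lc (toSite r) cΛ (j + 1))) 0 (unitM₂ sf sm (M2Of d Lc (mixFFAt (toSite r) Lc) (j + 1)))) κ u κ' u')
        + cB • B κ u κ' u') b a (Sum.inl a) (Sum.inl b)
      + (zmode Lc (fun κ u κ' u' => c • mmRead Lc (K3OfK (unitK sf sm (coDressKBmAt (toSite r) Lc (KInvStep (d := d) Lc (j + 1)))) Lc
        (unitS sf sm (SpureRecAt d Lc (toSite r) ((Lc : ℝ) ^ (d + 1)) (-((Lc : ℝ) ^ (d + 1) * (1 / 2) * (Lc : ℝ) ^ (d + 1))) cΛ (j + 1))) (unitM sf sm (M1At d Lc (toSite r) cΛ (j + 1)))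
        (W2SymOfK (unitK sf sm (coDressKBmAt (toSite r) Lc (KInvStep (d := d) Lc (j + 1)))) Lc
          (unitS sf sm (SpureRecAt d Lc (toSite r) ((Lc : ℝ) ^ (d + 1)) (-((Lc : ℝ) ^ (d + 1) * (1 / 2) * (Lc : ℝ) ^ (d + 1))) cΛ (j + 1)))
          (unitM sf sm (M1At d Lc (toSite r) cΛ (j + 1))) 0 (unitM₂ sf sm (M2Of d Lc (mixFFAt (toSite r) Lc) (j + 1)))) κ u κ' u')
        + cB • B κ u κ' u') a b (Sum.inl b) (Sum.inl a)
      + zmode Lc (fun κ u κ' u' => c • mmRead Lc (K3OfK (unitK sf sm (coDressKBmAt (toSite r) Lc (KInvStep (d := d) Lc (j + 1)))) Lc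
        (unitS sf sm (SpureRecAt d Lc (toSite r) ((Lc : ℝ) ^ (d + 1)) (-((Lc : ℝ) ^ (d + 1) * (1 / 2) * (Lc : ℝ) ^ (d + 1))) cΛ (j + 1))) (unitM sf sm (M1At d Lc (toSite r) cΛ (j + 1)))
        (W2SymOfK (unitK sf sm (coDressKBmAt (toSite r) Lc (KInvStep (d := d) Lc (j + 1)))) Lc
          (unitS sf sm (SpureRecAt d Lc (toSite r) ((Lc : ℝ) ^ (d + 1)) (-((Lc : ℝ) ^ (d + 1) * (1 / 2) * (Lc : ℝ) ^ (d + 1))) cΛ (j + 1)))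
          (unitM sf sm (M1At d Lc (toSite r) cΛ (j + 1))) 0 (unitM₂ sf sm (M2Of d Lc (mixFFAt (toSite r) Lc) (j + 1)))) κ u κ' u')
        + cB • B κ u κ' u') b a (Sum.inl b) (Sum.inl a))
      = 2 * (c * (-((sf * sm * ((((Lc ^ (j + 1 + 1) : ℕ) : ℝ)) ^ (d + 1 + 1))⁻¹) * (sf * sm * ((((Lc ^ (j + 1 + 1) : ℕ) : ℝ)) ^ (d + 1 + 1))⁻¹)) * ((Lc : ℝ) * (Lc : ℝ))) *
          (((box (d + 1) Lc).card : ℝ) * (((Lc : ℝ) * (sm * sf)) * ((((Lc ^ (j + 1 + 1) : ℕ) : ℝ)) ^ (d + 1 + 1))⁻¹) ^ 2 *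
          ((((sf * sm)⁻¹ * (sf⁻¹ * sf⁻¹) * ((Lc : ℝ) ^ (d + 1) * wE d Lc (j + 1))) * (-(1 / 2 : ℝ))) * (((sf * sm)⁻¹ * (sf⁻¹ * sf⁻¹) * ((Lc : ℝ) ^ (d + 1) * wE d Lc (j + 1))) * (1 / 2 : ℝ)) *
            ((sf * sf) * ((wVH d Lc (j + 1))⁻¹ *
              ∑ x ∈ box (d + 1) Lc, ∑ f : Fin (d + 1),
                ((if f = b then ((Lc : ℝ)⁻¹ * (Lc : ℝ)⁻¹) * ((((toSite x a % (Lc : ℤ) : ℤ) : ℝ) - ((Lc : ℝ) - 1) / 2)) else 0)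
                  + (if f = a then (-(Lc : ℝ)⁻¹ * ((((toSite x b % (Lc : ℤ) : ℤ) : ℝ) - ((Lc : ℝ) - 1) / 2))) * (if toSite x a % (Lc : ℤ) = (Lc : ℤ) - 1 then (1 : ℝ) else 0) else 0)) *
                ∑' s : Site (d + 1), ∑ f' : Fin (d + 1), E2 d Lc (j + 1) (toSite x) s (Sum.inl f) (Sum.inl f') *
                  ((if f' = a then ((Lc : ℝ)⁻¹ * (Lc : ℝ)⁻¹) * ((((s b % (Lc : ℤ) : ℤ) : ℝ) - ((Lc : ℝ) - 1) / 2)) else 0)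
                    + (if f' = b then (-(Lc : ℝ)⁻¹ * ((((s a % (Lc : ℤ) : ℤ) : ℝ) - ((Lc : ℝ) - 1) / 2))) * (if s b % (Lc : ℤ) = (Lc : ℤ) - 1 then (1 : ℝ) else 0) else 0)))))
          + ((box (d + 1) Lc).card : ℝ) * (((Lc : ℝ) * (sm * sf)) * ((((Lc ^ (j + 1 + 1) : ℕ) : ℝ)) ^ (d + 1 + 1))⁻¹) ^ 2 *
          ((((sf * sm)⁻¹ * (sf⁻¹ * sf⁻¹) * ((Lc : ℝ) ^ (d + 1) * wE d Lc (j + 1))) * (-(1 / 2 : ℝ))) * (((sf * sm)⁻¹ * (sf⁻¹ * sf⁻¹) * ((Lc : ℝ) ^ (d + 1) * wE d Lc (j + 1))) * (1 / 2 : ℝ)) *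
            ((sf * sf) * ((wVH d Lc (j + 1))⁻¹ *
              ∑ x ∈ box (d + 1) Lc, ∑ f : Fin (d + 1),
                ((if f = a then ((Lc : ℝ)⁻¹ * (Lc : ℝ)⁻¹) * ((((toSite x b % (Lc : ℤ) : ℤ) : ℝ) - ((Lc : ℝ) - 1) / 2)) else 0)
                  + (if f = b then (-(Lc : ℝ)⁻¹ * ((((toSite x a % (Lc : ℤ) : ℤ) : ℝ) - ((Lc : ℝ) - 1) / 2))) * (if toSite x b % (Lc : ℤ) = (Lc : ℤ) - 1 then (1 : ℝ) else 0) else 0)) *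
                ∑' s : Site (d + 1), ∑ f' : Fin (d + 1), E2 d Lc (j + 1) (toSite x) s (Sum.inl f) (Sum.inl f') *
                  ((if f' = b then ((Lc : ℝ)⁻¹ * (Lc : ℝ)⁻¹) * ((((s a % (Lc : ℤ) : ℤ) : ℝ) - ((Lc : ℝ) - 1) / 2)) else 0)
                    + (if f' = a then (-(Lc : ℝ)⁻¹ * ((((s b % (Lc : ℤ) : ℤ) : ℝ) - ((Lc : ℝ) - 1) / 2))) * (if s a % (Lc : ℤ) = (Lc : ℤ) - 1 then (1 : ℝ) else 0) else 0))))))) := by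
  have hba : b ≠ a := fun h => hab h.symm
  rw [zmode_dressedSource_succ_an1_inl_inl hLc hr sf sm cΛ j hBff c cB,
    zmode_dressedSource_succ_an1_inl_inl hLc hr sf sm cΛ j hBff c cB,
    zmode_dressedSource_succ_an1_inl_inl hLc hr sf sm cΛ j hBff c cB,
    zmode_dressedSource_succ_an1_inl_inl hLc hr sf sm cΛ j hBff c cB,
    eeWords_eq_pairForm hr sf sm ((Lc : ℝ) ^ (d + 1) * wE d Lc (j + 1)) cΛ j,
    eeWords_eq_pairForm hr sf sm ((Lc : ℝ) ^ (d + 1) * wE d Lc (j + 1)) cΛ j,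
    eeWords_eq_pairForm hr sf sm ((Lc : ℝ) ^ (d + 1) * wE d Lc (j + 1)) cΛ j,
    eeWords_eq_pairForm hr sf sm ((Lc : ℝ) ^ (d + 1) * wE d Lc (j + 1)) cΛ j,
    if_pos (Or.inl rfl : a = a ∨ b = b), if_pos (Or.inl rfl : b = b ∨ a = a),
    if_neg (not_or.mpr ⟨hba, hab⟩ : ¬(b = a ∨ a = b)), if_neg (not_or.mpr ⟨hab, hba⟩ : ¬(a = b ∨ b = a))]
  ring

/-! ## §6 The same VALUE in road-P2's letters (`d = 3`, E pins) — the cell summand `X(zmode_Lc b̃_(j+1))` of leaf-03's `CrossedLedgerForcing` -/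

/-- NOT IN PRINT; OUR BOOKKEEPING.  **§5 AT `d = 3` IN road-P2's LETTERS** (units `sfStep Lc (j+1)`, `smStep 3 Lc (j+1)`, scale `cE₂ * Lc^(2*(3+1))`, an1's tables, E pins
`cE := Lc^(3+1)`, `cVH := −(Lc^(3+1)·(1∕2)·Lc^(3+1))` written in, ANY border `vh₂S` without ff block; in-block root, `3 ≤ Lc`; any `cΛ cE₂ cB`; `a ≠ b`): the crossed orbit sum of the
level-`(j+1)` forcing's ff cell zero mode — leaf-03 g71's `X(zmode_Lc b̃_(l+1))` with the E pins substituted — equals twice the scaled sum of J2's two crossed Green's-function pairings. -/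
theorem crossed_zmode_forcing_succ_lit {r : Fin (3 + 1) → ℕ} (hLc : 3 ≤ Lc) (hr : r ∈ box (3 + 1) Lc) (cΛ cE₂ cB : ℝ)
    {vh₂S : Tab 3} (hBff : ∀ κ u κ' u' x z (α β : Fin (3 + 1)), vh₂S κ u κ' u' x z (Sum.inl α) (Sum.inl β) = 0) (j : ℕ)
    {a b : Fin (3 + 1)} (hab : a ≠ b) :
    zmode Lc ((fun κ u κ' u' => (cE₂ * (Lc : ℝ) ^ (2 * (3 + 1))) • mmRead Lc (K3OfK (unitK (sfStep Lc (j + 1)) (smStep 3 Lc (j + 1)) (coDressKBmAt (toSite r) Lc (KInvStep (d := 3) Lc (j + 1)))) Lc (unitS (sfStep Lc (j + 1)) (smStep 3 Lc (j + 1)) (SpureRecAt 3 Lc (toSite r) ((Lc : ℝ) ^ (3 + 1)) (-((Lc : ℝ) ^ (3 + 1) * (1 / 2) * (Lc : ℝ) ^ (3 + 1))) cΛ (j + 1))) (unitM (sfStep Lc (j + 1)) (smStep 3 Lc (j + 1)) (M1At 3 Lc (toSite r) cΛ (j + 1))) (W2SymOfK (unitK (sfStep Lc (j + 1)) (smStep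 3 Lc (j + 1)) (coDressKBmAt (toSite r) Lc (KInvStep (d := 3) Lc (j + 1)))) Lc (unitS (sfStep Lc (j + 1)) (smStep 3 Lc (j + 1)) (SpureRecAt 3 Lc (toSite r) ((Lc : ℝ) ^ (3 + 1)) (-((Lc : ℝ) ^ (3 + 1) * (1 / 2) * (Lc : ℝ) ^ (3 + 1))) cΛ (j + 1))) (unitM (sfStep Lc (j + 1)) (smStep 3 Lc (j + 1)) (M1At 3 Lc (toSite r) cΛ (j + 1))) 0 (unitM₂ (sfStep Lc (j + 1)) (smStep 3 Lc (j + 1)) (M2Of 3 Lc (mixFFAt (toSite r) Lc) (j + 1)))) κ u κ' u') + cB • vh₂S κ u κ' u')) a b (Sum.inl a) (Sum.inl b)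
      + zmode Lc ((fun κ u κ' u' => (cE₂ * (Lc : ℝ) ^ (2 * (3 + 1))) • mmRead Lc (K3OfK (unitK (sfStep Lc (j + 1)) (smStep 3 Lc (j + 1)) (coDressKBmAt (toSite r) Lc (KInvStep (d := 3) Lc (j + 1)))) Lc (unitS (sfStep Lc (j + 1)) (smStep 3 Lc (j + 1)) (SpureRecAt 3 Lc (toSite r) ((Lc : ℝ) ^ (3 + 1)) (-((Lc : ℝ) ^ (3 + 1) * (1 / 2) * (Lc : ℝ) ^ (3 + 1))) cΛ (j + 1))) (unitM (sfStep Lc (j + 1)) (smStep 3 Lc (j + 1)) (M1At 3 Lc (toSite r) cΛ (j + 1))) (W2SymOfK (unitK (sfStep Lc (j + 1)) (smStep 3 Lc (j + 1)) (coDressKBmAt (toSite r) Lc (KInvStep (d := 3) Lc (j + 1)))) Lc (unitS (sfStep Lc (j + 1)) (smStep 3 Lc (j + 1)) (SpureRecAt 3 Lc (toSite r) ((Lc : ℝ) ^ (3 + 1)) (-((Lc : ℝ) ^ (3 + 1) * (1 / 2) * (Lc : ℝ) ^ (3 + 1))) cΛ (j + 1))) (unitM (sfStep Lc (j + 1)) (smStep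 3 Lc (j + 1)) (M1At 3 Lc (toSite r) cΛ (j + 1))) 0 (unitM₂ (sfStep Lc (j + 1)) (smStep 3 Lc (j + 1)) (M2Of 3 Lc (mixFFAt (toSite r) Lc) (j + 1)))) κ u κ' u') + cB • vh₂S κ u κ' u')) b a (Sum.inl a) (Sum.inl b)
      + (zmode Lc ((fun κ u κ' u' => (cE₂ * (Lc : ℝ) ^ (2 * (3 + 1))) • mmRead Lc (K3OfK (unitK (sfStep Lc (j + 1)) (smStep 3 Lc (j + 1)) (coDressKBmAt (toSite r) Lc (KInvStep (d := 3) Lc (j + 1)))) Lc (unitS (sfStep Lc (j + 1)) (smStep 3 Lc (j + 1)) (SpureRecAt 3 Lc (toSite r) ((Lc : ℝ) ^ (3 + 1)) (-((Lc : ℝ) ^ (3 + 1) * (1 / 2) * (Lc : ℝ) ^ (3 + 1))) cΛ (j + 1))) (unitM (sfStep Lc (j + 1)) (smStep 3 Lc (j + 1)) (M1At 3 Lc (toSite r) cΛ (j + 1))) (W2SymOfK (unitK (sfStep Lc (j + 1)) (smStep 3 Lc (j + 1)) (coDressKBmAt (toSite r) Lc (KInvStep (d := 3) Lc (j + 1))))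 Lc (unitS (sfStep Lc (j + 1)) (smStep 3 Lc (j + 1)) (SpureRecAt 3 Lc (toSite r) ((Lc : ℝ) ^ (3 + 1)) (-((Lc : ℝ) ^ (3 + 1) * (1 / 2) * (Lc : ℝ) ^ (3 + 1))) cΛ (j + 1))) (unitM (sfStep Lc (j + 1)) (smStep 3 Lc (j + 1)) (M1At 3 Lc (toSite r) cΛ (j + 1))) 0 (unitM₂ (sfStep Lc (j + 1)) (smStep 3 Lc (j + 1)) (M2Of 3 Lc (mixFFAt (toSite r) Lc) (j + 1)))) κ u κ' u') + cB • vh₂S κ u κ' u')) a b (Sum.inl b) (Sum.inl a)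
      + zmode Lc ((fun κ u κ' u' => (cE₂ * (Lc : ℝ) ^ (2 * (3 + 1))) • mmRead Lc (K3OfK (unitK (sfStep Lc (j + 1)) (smStep 3 Lc (j + 1)) (coDressKBmAt (toSite r) Lc (KInvStep (d := 3) Lc (j + 1)))) Lc (unitS (sfStep Lc (j + 1)) (smStep 3 Lc (j + 1)) (SpureRecAt 3 Lc (toSite r) ((Lc : ℝ) ^ (3 + 1)) (-((Lc : ℝ) ^ (3 + 1) * (1 / 2) * (Lc : ℝ) ^ (3 + 1))) cΛ (j + 1))) (unitM (sfStep Lc (j + 1)) (smStep 3 Lc (j + 1)) (M1At 3 Lc (toSite r) cΛ (j + 1))) (W2SymOfK (unitK (sfStep Lc (j + 1)) (smStep 3 Lc (j + 1)) (coDressKBmAt (toSite r) Lc (KInvStep (d := 3) Lc (j + 1)))) Lc (unitS (sfStep Lc (j + 1)) (smStep 3 Lc (j + 1)) (SpureRecAt 3 Lc (toSite r) ((Lc : ℝ) ^ (3 + 1)) (-((Lc : ℝ) ^ (3 + 1) * (1 / 2) * (Lc : ℝ) ^ (3 + 1))) cΛ (j + 1))) (unitM (sfStep Lc (j + 1)) (smStep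 3 Lc (j + 1)) (M1At 3 Lc (toSite r) cΛ (j + 1))) 0 (unitM₂ (sfStep Lc (j + 1)) (smStep 3 Lc (j + 1)) (M2Of 3 Lc (mixFFAt (toSite r) Lc) (j + 1)))) κ u κ' u') + cB • vh₂S κ u κ' u')) b a (Sum.inl b) (Sum.inl a))
      = 2 * ((cE₂ * (Lc : ℝ) ^ (2 * (3 + 1))) * (-(((sfStep Lc (j + 1)) * (smStep 3 Lc (j + 1)) * ((((Lc ^ (j + 1 + 1) : ℕ) : ℝ)) ^ (3 + 1 + 1))⁻¹) * ((sfStep Lc (j + 1)) * (smStep 3 Lc (j + 1)) * ((((Lc ^ (j + 1 + 1) : ℕ) : ℝ)) ^ (3 + 1 + 1))⁻¹)) * ((Lc : ℝ) * (Lc : ℝ))) *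
          (((box (3 + 1) Lc).card : ℝ) * (((Lc : ℝ) * ((smStep 3 Lc (j + 1)) * (sfStep Lc (j + 1)))) * ((((Lc ^ (j + 1 + 1) : ℕ) : ℝ)) ^ (3 + 1 + 1))⁻¹) ^ 2 *
          (((((sfStep Lc (j + 1)) * (smStep 3 Lc (j + 1)))⁻¹ * ((sfStep Lc (j + 1))⁻¹ * (sfStep Lc (j + 1))⁻¹) * ((Lc : ℝ) ^ (3 + 1) * wE 3 Lc (j + 1))) * (-(1 / 2 : ℝ))) * ((((sfStep Lc (j + 1)) * (smStep 3 Lc (j + 1)))⁻¹ * ((sfStep Lc (j + 1))⁻¹ * (sfStep Lc (j + 1))⁻¹) * ((Lc : ℝ) ^ (3 + 1) * wE 3 Lc (j + 1))) * (1 / 2 : ℝ)) *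
            (((sfStep Lc (j + 1)) * (sfStep Lc (j + 1))) * ((wVH 3 Lc (j + 1))⁻¹ *
              ∑ x ∈ box (3 + 1) Lc, ∑ f : Fin (3 + 1),
                ((if f = b then ((Lc : ℝ)⁻¹ * (Lc : ℝ)⁻¹) * ((((toSite x a % (Lc : ℤ) : ℤ) : ℝ) - ((Lc : ℝ) - 1) / 2)) else 0)
                  + (if f = a then (-(Lc : ℝ)⁻¹ * ((((toSite x b % (Lc : ℤ) : ℤ) : ℝ) - ((Lc : ℝ) - 1) / 2))) * (if toSite x a % (Lc : ℤ) = (Lc : ℤ) - 1 then (1 : ℝ) else 0) else 0)) *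
                ∑' s : Site (3 + 1), ∑ f' : Fin (3 + 1), E2 3 Lc (j + 1) (toSite x) s (Sum.inl f) (Sum.inl f') *
                  ((if f' = a then ((Lc : ℝ)⁻¹ * (Lc : ℝ)⁻¹) * ((((s b % (Lc : ℤ) : ℤ) : ℝ) - ((Lc : ℝ) - 1) / 2)) else 0)
                    + (if f' = b then (-(Lc : ℝ)⁻¹ * ((((s a % (Lc : ℤ) : ℤ) : ℝ) - ((Lc : ℝ) - 1) / 2))) * (if s b % (Lc : ℤ) = (Lc : ℤ) - 1 then (1 : ℝ) else 0) else 0)))))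
          + ((box (3 + 1) Lc).card : ℝ) * (((Lc : ℝ) * ((smStep 3 Lc (j + 1)) * (sfStep Lc (j + 1)))) * ((((Lc ^ (j + 1 + 1) : ℕ) : ℝ)) ^ (3 + 1 + 1))⁻¹) ^ 2 *
          (((((sfStep Lc (j + 1)) * (smStep 3 Lc (j + 1)))⁻¹ * ((sfStep Lc (j + 1))⁻¹ * (sfStep Lc (j + 1))⁻¹) * ((Lc : ℝ) ^ (3 + 1) * wE 3 Lc (j + 1))) * (-(1 / 2 : ℝ))) * ((((sfStep Lc (j + 1)) * (smStep 3 Lc (j + 1)))⁻¹ * ((sfStep Lc (j + 1))⁻¹ * (sfStep Lc (j + 1))⁻¹) * ((Lc : ℝ) ^ (3 + 1) * wE 3 Lc (j + 1))) * (1 / 2 : ℝ)) *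
            (((sfStep Lc (j + 1)) * (sfStep Lc (j + 1))) * ((wVH 3 Lc (j + 1))⁻¹ *
              ∑ x ∈ box (3 + 1) Lc, ∑ f : Fin (3 + 1),
                ((if f = a then ((Lc : ℝ)⁻¹ * (Lc : ℝ)⁻¹) * ((((toSite x b % (Lc : ℤ) : ℤ) : ℝ) - ((Lc : ℝ) - 1) / 2)) else 0)
                  + (if f = b then (-(Lc : ℝ)⁻¹ * ((((toSite x a % (Lc : ℤ) : ℤ) : ℝ) - ((Lc : ℝ) - 1) / 2))) * (if toSite x b % (Lc : ℤ) = (Lc : ℤ) - 1 then (1 : ℝ) else 0) else 0)) *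
                ∑' s : Site (3 + 1), ∑ f' : Fin (3 + 1), E2 3 Lc (j + 1) (toSite x) s (Sum.inl f) (Sum.inl f') *
                  ((if f' = b then ((Lc : ℝ)⁻¹ * (Lc : ℝ)⁻¹) * ((((s a % (Lc : ℤ) : ℤ) : ℝ) - ((Lc : ℝ) - 1) / 2)) else 0)
                    + (if f' = a then (-(Lc : ℝ)⁻¹ * ((((s b % (Lc : ℤ) : ℤ) : ℝ) - ((Lc : ℝ) - 1) / 2))) * (if s a % (Lc : ℤ) = (Lc : ℤ) - 1 then (1 : ℝ) else 0) else 0))))))) :=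
  crossed_zmode_forcing_succ (d := 3) hLc hr (sfStep Lc (j + 1)) (smStep 3 Lc (j + 1)) cΛ j hBff (cE₂ * (Lc : ℝ) ^ (2 * (3 + 1))) cB hab

end Summit.QuantumFields.BalabanUV.Beta.GAN24.ForcingCellPairFormSucc

end
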